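import Literature.NumberTheory.DiophantineGeometry.SuperellipticHeightsTFamily
import Literature.NumberTheory.DiophantineGeometry.SuperellipticHeightsNFamily
import Literature.NumberTheory.DiophantineGeometry.GenEllDePoint
import HarnessLib

/-!
# Height inputs `htH`, `hNH` of the W5 kernel junction for the family `t_c` on `r^e = x(1-x)`

[GenEll] = S. Mochizuki, *Arithmetic elliptic curves in general position*, Math. J. Okayama Univ. 52
(2010), Prop. 1.4 (i); abc-iut cell, route item `Summit.ABC.ABC.Theses.IUTThetaPilot.GenEllTwo`, S6's
plan GENELLTWO-P1ROUTE v2 §4, package W4a-c. The W5 kernel junction for the family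
`t_c = 1/r + c·r^{k+1}/s` (w5-d045, `GenEll.DeC.inv_finrank_mul_sum_logNorm_le_slope`, p416504) is
stated over a tuple `(c, r, s, t, N, x)` of elements of a number field `L` with

  `s² = 1 − 4r^{2k+1}`,  `t·(r·s) = s + c·r^{k+2}`,  `N = −s³ + c((k+1)·r^{k+2} − 2·r^{3k+3})`,

and consumes two Weil-height inputs `htH : (2k+1)·h_L(t) ≤ (2k+4)·h_L(x) + [L:ℚ]·C₄` and
`hNH : (6k+6)·h_L(x) ≤ (2k+1)·h_L(N) + [L:ℚ]·C₅`. This file produces BOTH, with constants depending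
only on `(k, c)` for `c = q ∈ ℚ^×`, from the coordinates `(x, r)` of a point of `D_e` (`r^{2k+1} = x(1-x)`,
`x ∉ {0, 1, 1/2}`, `s := 1 − 2x`) — i.e. in the variables W9 instantiates the junction with — by rewriting
`t = 1/r + q·r^{k+1}/s` and invoking `Superelliptic.exists_tFunC_le_of_rat` (p416284) and
`Superelliptic.exists_NC_ge_of_rat` (p416537). (The junction's `hcurve : s² = 1 − 4r^{2k+1}` is
`by rw [hs, hr]; ring` from `s = 1 − 2x`, `r^{2k+1} = x(1−x)`.)

Everything is proved; no definitions, no named facts; classical height theory — nothing here refers to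
the disputed parts of the abc-iut corpus.
-/

noncomputable section

open Height

namespace Literature.NumberTheory.DiophantineGeometry

namespace Superelliptic

/-- From `t·(r·s) = s + c·r^{k+2}` with `r ≠ 0`, `s ≠ 0`: `t = 1/r + c·r^{k+1}/s`
(the two presentations of `t_c`, W5's `ht` versus W4a's `tFun`). [folklore] -/
private theorem t_eq_of_mul_eq {L : Type*} [Field L] {k : ℕ} {c r s t : L} (hr0 : r ≠ 0) (hs0 : s ≠ 0)
    (ht : t * (r * s) = s + c * r ^ (k + 2)) : t = r⁻¹ + c * (r ^ (k + 1) / s) := by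
  rw [eq_div_of_mul_eq (mul_ne_zero hr0 hs0) ht]
  field_simp
  ring

/-- **Height inputs of the W5 kernel junction, family `t_c`, `c = q ∈ ℚ^×`** (`e = 2k+1`, `k ≥ 1`):
there are `C₄`, `C₅` depending only on `(k, q)` such that for every number field `L` and every
`x, r, s, t, N ∈ L` with `s = 1 − 2x`, `r^{2k+1} = x(1−x)`, `x ∉ {0, 1}`, `s ≠ 0`,
`t·(r·s) = s + q·r^{k+2}` and `N = −s³ + q((k+1)·r^{k+2} − 2·r^{3k+3})`:
`(2k+1)·h_L(t) ≤ (2k+4)·h_L(x) + [L:ℚ]·C₄` and `(6k+6)·h_L(x) ≤ (2k+1)·h_L(N) + [L:ℚ]·C₅` — the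
hypotheses `htH`, `hNH` of `GenEll.DeC.inv_finrank_mul_sum_logNorm_le_slope` VERBATIM ([GenEll] Prop. 1.4
(i), (iii) for `t_c, N_c, x : D_e → ℙ¹`: `e·(t_c)_∞ ∼ (e+3)(x)_∞`, `e·(N_c)_∞ = (3e+3)(x)_∞`).
[cite: MochizukiGenEll2010, Prop 1.4 (i) p.6] -/
theorem exists_junction_heights_of_rat (k : ℕ) (hk : 1 ≤ k) (q : ℚ) (hq : q ≠ 0) :
    ∃ C₄ C₅ : ℝ, ∀ (L : Type) [Field L] [NumberField L] (x r s t N : L),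
      s = 1 - 2 * x → r ^ (2 * k + 1) = x * (1 - x) → x ≠ 0 → x ≠ 1 → s ≠ 0 →
      t * (r * s) = s + (q : L) * r ^ (k + 2) →
      N = -s ^ 3 + (q : L) * (((k : L) + 1) * r ^ (k + 2) - 2 * r ^ (3 * k + 3)) →
      (2 * k + 1 : ℝ) * logHeight₁ t ≤ (2 * k + 4 : ℝ) * logHeight₁ x + Module.finrank ℚ L * C₄ ∧
      (6 * k + 6 : ℝ) * logHeight₁ x ≤ (2 * k + 1 : ℝ) * logHeight₁ N + Module.finrank ℚ L * C₅ := by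
  obtain ⟨C₄, hC₄⟩ := exists_tFunC_le_of_rat k hk q hq
  obtain ⟨C₅, hC₅⟩ := exists_NC_ge_of_rat k q hq
  refine ⟨C₄, C₅, fun L _ _ x r s t N hs hr hx0 hx1 hs0 ht hN => ⟨?_, ?_⟩⟩
  · have hr0 : r ≠ 0 := by
      intro h
      rw [h, zero_pow (by omega)] at hr
      exact mul_ne_zero hx0 (sub_ne_zero.mpr (Ne.symm hx1)) hr.symm
    have hs0' : (1 : L) - 2 * x ≠ 0 := hs ▸ hs0
    rw [t_eq_of_mul_eq hr0 hs0 ht, hs]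
    exact hC₄ L x r hr hx0 hx1 hs0'
  · rw [hN, hs]
    exact hC₅ L x r hr

/-- **General `c ∈ L^×` form of `htH`** (the dependence on `c` through its height): for `e = 2k+1`,
`k ≥ 1`, there is `C` depending only on `k` with
`(2k+1)·h_L(t) ≤ (2k+4)·h_L(x) + [L:ℚ]·C + 3(2k+1)·h_L(c)` whenever `s = 1 − 2x`, `r^{2k+1} = x(1−x)`,
`x ∉ {0,1}`, `s ≠ 0`, `c ≠ 0`, `t·(r·s) = s + c·r^{k+2}`. [cite: MochizukiGenEll2010, Prop 1.4 (i) p.6] -/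
theorem exists_junction_ht (k : ℕ) (hk : 1 ≤ k) :
    ∃ C : ℝ, ∀ (L : Type) [Field L] [NumberField L] (x r s t c : L),
      s = 1 - 2 * x → r ^ (2 * k + 1) = x * (1 - x) → x ≠ 0 → x ≠ 1 → s ≠ 0 → c ≠ 0 →
      t * (r * s) = s + c * r ^ (k + 2) →
      (2 * k + 1 : ℝ) * logHeight₁ t ≤
        (2 * k + 4 : ℝ) * logHeight₁ x + Module.finrank ℚ L * C + 3 * (2 * k + 1) * logHeight₁ c := by
  obtain ⟨C, hC⟩ := exists_abs_logHeight₁_tFunC_sub_le (e := 2 * k + 1) (m' := k + 1)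
    (by omega) (by omega)
  refine ⟨C, fun L _ _ x r s t c hs hr hx0 hx1 hs0 hc ht => ?_⟩
  have hr0 : r ≠ 0 := by
    intro h
    rw [h, zero_pow (by omega)] at hr
    exact mul_ne_zero hx0 (sub_ne_zero.mpr (Ne.symm hx1)) hr.symm
  have hs0' : (1 : L) - 2 * x ≠ 0 := hs ▸ hs0
  rw [t_eq_of_mul_eq hr0 hs0 ht, hs]
  have h := (abs_le.mp (hC L x r c hr hx0 hx1 hs0' hc)).2
  push_cast at h
  linarith


/-! ### The same over the `D_e`-point `P.dePoint (2k+1)` (W9 assembly currency) — appended -/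

/-- **`htH`, `hNH` of the W5 junction at the `D_e`-point over `P`.** For a presented point
`P = (F, x)` of `U` and its `D_e`-point `Q := P.dePoint (2k+1) = (F(r), x)` (w5-d015,
`r = P.deRoot (2k+1)`, `r^{2k+1} = x(1−x)`), every `s, t, N ∈ F(r)` with `s = 1 − 2x ≠ 0`,
`t·(r·s) = s + q·r^{k+2}`, `N = −s³ + q((k+1)·r^{k+2} − 2·r^{3k+3})` satisfy the two height
hypotheses of `GenEll.DeC.inv_finrank_mul_sum_logNorm_le_slope` over `L = F(r)` with `x := Q.x`,
constants depending on `(k, q)` only. [cite: MochizukiGenEll2010, Prop 1.4 (i) p.6] -/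
theorem exists_junction_heights_dePoint (k : ℕ) (hk : 1 ≤ k) (q : ℚ) (hq : q ≠ 0) :
    ∃ C₄ C₅ : ℝ, ∀ (P : GenEll.NFPoint) (s t N : (P.dePoint (2 * k + 1)).F), P.InU →
      s = 1 - 2 * (P.dePoint (2 * k + 1)).x → s ≠ 0 →
      t * (P.deRoot (2 * k + 1) * s) = s + (q : (P.dePoint (2 * k + 1)).F) * P.deRoot (2 * k + 1) ^ (k + 2) →
      N = -s ^ 3 + (q : (P.dePoint (2 * k + 1)).F) *
        (((k : (P.dePoint (2 * k + 1)).F) + 1) * P.deRoot (2 * k + 1) ^ (k + 2) -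
          2 * P.deRoot (2 * k + 1) ^ (3 * k + 3)) →
      (2 * k + 1 : ℝ) * logHeight₁ t ≤ (2 * k + 4 : ℝ) * logHeight₁ (P.dePoint (2 * k + 1)).x +
          Module.finrank ℚ (P.dePoint (2 * k + 1)).F * C₄ ∧
      (6 * k + 6 : ℝ) * logHeight₁ (P.dePoint (2 * k + 1)).x ≤ (2 * k + 1 : ℝ) * logHeight₁ N +
          Module.finrank ℚ (P.dePoint (2 * k + 1)).F * C₅ := by
  obtain ⟨C₄, C₅, h⟩ := exists_junction_heights_of_rat k hk q hq
  refine ⟨C₄, C₅, fun P s t N hP hs hs0 ht hN => ?_⟩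
  have hQU : (P.dePoint (2 * k + 1)).InU := (GenEll.NFPoint.inU_dePoint_iff P (2 * k + 1)).mpr hP
  have hr : P.deRoot (2 * k + 1) ^ (2 * k + 1) =
      (P.dePoint (2 * k + 1)).x * (1 - (P.dePoint (2 * k + 1)).x) := by
    rw [GenEll.NFPoint.deRoot_pow P (2 * k + 1) (by omega), GenEll.NFPoint.dePoint_x, map_mul, map_sub,
      map_one]
  exact h (P.dePoint (2 * k + 1)).F (P.dePoint (2 * k + 1)).x (P.deRoot (2 * k + 1)) s t N hs hr
    hQU.1 hQU.2 hs0 ht hN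

end Superelliptic

end Literature.NumberTheory.DiophantineGeometry

end
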